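import Literature.NumberTheory.EllipticCurves.LocalIndexBadPoints
import HarnessLib

/-!
# The local index for type `III`: `c_v = 2` (proof)

Discharge of the named fact
`Literature.NumberTheory.EllipticCurves.localTamagawaNumber_eq_two_of_kodairaSymbolAt_eq_III`
(`NeronComponentIndex.lean`; Silverman, *ATAEC*, IV.9.4 Step 4, PDF p. 344: "If `π³ ∤ b₈`,
then Type III, `m = 2`, `f = v(Δ) − 1`, `c = 2`"), by the elementary tools of
`LocalIndexBadPoints.lean`; no Néron model is used.

## Proof

Let `R` be a Henselian discrete valuation ring with perfect residue field and `I` an equation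
over `R` with `Δ ≠ 0` on which Tate's algorithm stops at Step 4.

1. *Normal form* (`exists_smul_of_kodairaSymbolOfMinimal_eq_III`): after the Step-2 translation
   and `y ↦ y + sx` with `s̄` the double root of `Y² + ā₁Y − ā₂` (which exists because `π ∣ b₂`
   and the residue field is perfect, `exists_root_step6`; the substitution has `r = t = 0`, so it
   fixes `a₃`, `a₆`, `b₈`), the model `J = D • I` has `a₁, a₂, a₃, a₄ ∈ 𝔪`, `a₆ ∈ 𝔪²`, and then
   `b₈ ≡ −a₄² (mod 𝔪³)`, so the Step-4 test `π³ ∤ b₈` reads `π² ∤ a₄`: `a₄ = πδ`, `δ ∈ Rˣ`.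
2. *Bad points* of `J` are the integral points `(x, y) ∈ 𝔪 × 𝔪` (`LocalIndexBadPoints`); for
   two of them `N = x₁² + x₁x₂ + x₂² + a₂(x₁ + x₂) + a₄ − a₁y₂ = π(δ + π·(…))` is `π` times a unit
   and `π ∣ D = y₁ + y₂ + a₁x₁ + a₃`, so their sum lies in `E₀(K)`
   (`hasNonsingularReduction_add_of_slope` with `e = 1`).
3. *A bad point exists*: `(πt, 0)` with `t` a root of `πt³ + a₂t² + δt + a₆/π²` (Hensel,
   `exists_root_of_henselian`).
4. Hence `[J(K) : E₀] = 2` (`index_eq_two_of_forall_add_mem`), and the index is the same for `I`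
   (`index_nonsingularReductionSubgroup_smul`). At a place `v` this is `c_v = 2`, through the
   bridge `goodReductionSubgroup_baseChange_eq` of `TamagawaSubgroupProofs` (`O_v` is Henselian:
   `adicCompletionIntegers.henselianLocalRing`).

## References

* J. H. Silverman, *Advanced Topics in the Arithmetic of Elliptic Curves*, GTM 151, Springer
  1994, IV.9.4 Step 4 (PDF p. 344) and its proof (PDF pp. 347–348; Fig. 4.4: the special fibre
  consists of two rational curves tangent at one point, each of multiplicity one).
  [SilvermanATAEC1994]
-/

noncomputable section

open scoped Classical

open IsLocalRing

namespace Literature.NumberTheory.EllipticCurves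

namespace LocalIndex

open DiophantineGeometry DiophantineGeometry.TateAlgorithm

variable {R : Type*} [CommRing R] [IsDomain R] [IsDiscreteValuationRing R]

/-! ### Step 4 fired: the normal form -/

/-- Tate's tree returns `III` exactly when the first three tests fail and the fourth fires.
[folklore] -/
theorem tateTree_eq_III_iff (p1 p2 p3 p4 : Prop) [Decidable p1] [Decidable p2] [Decidable p3]
    [Decidable p4] (n : ℕ) (rest : KodairaSymbol)
    (hrest : rest ≠ .III) :
    (if p1 then KodairaSymbol.I 0 else if p2 then .I n else if p3 then .II else if p4 then .III
      else rest) = .III ↔ ¬ p1 ∧ ¬ p2 ∧ ¬ p3 ∧ p4 := by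
  split_ifs <;> simp [*]

/-- The part of Tate's tree after Step 4 never returns `III`. [folklore] -/
theorem tateTree_ne_III (p5 p6 p7 p8 p9 p10 : Prop) [Decidable p5] [Decidable p6]
    [Decidable p7] [Decidable p8] [Decidable p9] [Decidable p10] (n : ℕ) :
    (if p5 then KodairaSymbol.IV else if p6 then .Istar 0 else if p7 then .Istar n
      else if p8 then .IVstar else if p9 then .IIIstar else if p10 then .IIstar else .I 0) ≠
      .III := by
  split_ifs <;> simp

/-- **Step 4 fired.** `kodairaSymbolOfMinimal V = III` iff `π ∣ Δ` and, on the Step-2 model,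
`π ∣ b₂`, `π² ∣ a₆`, `π³ ∤ b₈`. [folklore] -/
theorem kodairaSymbolOfMinimal_eq_III_iff (V : WeierstrassCurve R) :
    V.kodairaSymbolOfMinimal = .III ↔
      ¬ V.Δ ∉ maximalIdeal R ∧ ¬ (normalizeStep2 V).b₂ ∉ maximalIdeal R ∧
      ¬ (normalizeStep2 V).a₆ ∉ maximalIdeal R ^ 2 ∧
      (normalizeStep2 V).b₈ ∉ maximalIdeal R ^ 3 := by
  unfold WeierstrassCurve.kodairaSymbolOfMinimal
  exact tateTree_eq_III_iff _ _ _ _ _ _ (tateTree_ne_III _ _ _ _ _ _ _)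

/-- **The normal form of type `III`.** Over a perfect residue field, if Tate's algorithm returns
`III` then some `R`-model `D • V` has `a₁, a₂, a₃, a₄ ∈ 𝔪`, `π² ∤ a₄`, `π² ∣ a₆`: compose the
Step-2 translation with `y ↦ y + sx`, `s̄` the double root of `Y² + ā₁Y − ā₂` (it fixes `a₃`, `a₆`
and `b₈`), after which `b₈ ≡ −a₄² (mod 𝔪³)` (Silverman, *ATAEC*, IV.9.4 Step 4; cf. the proof of
Ogg's formula, PDF p. 366: "`v(a₂) ≥ 1`, `v(a₄) = 1`, `v(a₆) ≥ 2`").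
[cite: SilvermanATAEC1994, IV.9.4 Step 4] -/
theorem exists_smul_of_kodairaSymbolOfMinimal_eq_III [PerfectField (ResidueField R)]
    (V : WeierstrassCurve R) (hV : V.kodairaSymbolOfMinimal = .III) :
    ∃ D : WeierstrassCurve.VariableChange R,
      (D • V).a₁ ∈ maximalIdeal R ∧ (D • V).a₂ ∈ maximalIdeal R ∧ (D • V).a₃ ∈ maximalIdeal R ∧
      (D • V).a₄ ∈ maximalIdeal R ∧ (D • V).a₄ ∉ maximalIdeal R ^ 2 ∧
      (D • V).a₆ ∈ maximalIdeal R ^ 2 := by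
  obtain ⟨h1, h2, h3, h4⟩ := (kodairaSymbolOfMinimal_eq_III_iff V).mp hV
  rw [not_not] at h1 h2 h3
  -- Step 2
  have hex2 := exists_variableChange_step2_of_perfectField V h1
  have hN2 : normalizeStep2 V = hex2.choose • V := dif_pos hex2
  obtain ⟨-, hA₃, hA₄, -⟩ := hex2.choose_spec
  rw [hN2] at h2 h3 h4
  set W₂ := hex2.choose • V with hW₂
  -- `y ↦ y + s x`
  have hres : residue R W₂.a₁ ^ 2 + 4 * residue R W₂.a₂ = 0 := by
    have := (residue_eq_zero_iff _).mpr h2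
    rwa [WeierstrassCurve.b₂, map_add, map_pow, map_mul, map_ofNat] at this
  obtain ⟨σ, h1σ, h2σ⟩ := exists_root_step6 _ _ hres
  obtain ⟨s, rfl⟩ := residue_surjective σ
  set C : WeierstrassCurve.VariableChange R := ⟨1, 0, s, 0⟩ with hC
  have e₁ : (C • W₂).a₁ = W₂.a₁ + 2 * s := by
    rw [WeierstrassCurve.variableChange_a₁, hC]; simp
  have e₂ : (C • W₂).a₂ = W₂.a₂ - s * W₂.a₁ - s ^ 2 := by
    rw [WeierstrassCurve.variableChange_a₂, hC]; simp
  have e₃ : (C • W₂).a₃ = W₂.a₃ := by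
    rw [WeierstrassCurve.variableChange_a₃, hC]; simp
  have e₄ : (C • W₂).a₄ = W₂.a₄ - s * W₂.a₃ := by
    rw [WeierstrassCurve.variableChange_a₄, hC]; simp
  have e₆ : (C • W₂).a₆ = W₂.a₆ := by
    rw [WeierstrassCurve.variableChange_a₆, hC]; simp
  have e₈ : (C • W₂).b₈ = W₂.b₈ := by
    rw [WeierstrassCurve.variableChange_b₈, hC]; simp
  have hB₁ : (C • W₂).a₁ ∈ maximalIdeal R := by
    rw [e₁, ← residue_eq_zero_iff, map_add, map_mul, map_ofNat]; exact h1σ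
  have hB₂ : (C • W₂).a₂ ∈ maximalIdeal R := by
    rw [e₂, ← residue_eq_zero_iff, map_sub, map_sub, map_mul, map_pow]
    linear_combination (-1 : ResidueField R) * h2σ
  have hB₃ : (C • W₂).a₃ ∈ maximalIdeal R := e₃ ▸ hA₃
  have hB₄ : (C • W₂).a₄ ∈ maximalIdeal R := e₄ ▸ Ideal.sub_mem _ hA₄ (Ideal.mul_mem_left _ _ hA₃)
  have hB₆ : (C • W₂).a₆ ∈ maximalIdeal R ^ 2 := e₆ ▸ h3
  refine ⟨C * hex2.choose, ?_⟩
  rw [mul_smul]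
  refine ⟨hB₁, hB₂, hB₃, hB₄, fun hsq => h4 ?_, hB₆⟩
  -- if `π² ∣ a₄` then `π³ ∣ b₈`
  rw [← e₈]
  have hb₈ : (C • W₂).b₈ = (C • W₂).a₁ ^ 2 * (C • W₂).a₆ + 4 * (C • W₂).a₂ * (C • W₂).a₆ -
      (C • W₂).a₁ * (C • W₂).a₃ * (C • W₂).a₄ + (C • W₂).a₂ * (C • W₂).a₃ ^ 2 -
      (C • W₂).a₄ ^ 2 := rfl
  rw [hb₈]
  have h22 : maximalIdeal R ^ 2 * maximalIdeal R ^ 2 ≤ maximalIdeal R ^ 3 := by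
    rw [← pow_add]; exact Ideal.pow_le_pow_right (by norm_num)
  have h12 : maximalIdeal R * maximalIdeal R ^ 2 ≤ maximalIdeal R ^ 3 := by
    rw [← pow_succ']
  have h111 : maximalIdeal R * maximalIdeal R * maximalIdeal R ≤ maximalIdeal R ^ 3 := by
    rw [pow_succ, pow_two]
  refine Ideal.sub_mem _ (Ideal.add_mem _ (Ideal.sub_mem _ (Ideal.add_mem _ ?_ ?_) ?_) ?_) ?_
  · exact h22 (Ideal.mul_mem_mul (Ideal.pow_mem_pow hB₁ 2) hB₆)
  · exact h12 (Ideal.mul_mem_mul (Ideal.mul_mem_left _ _ hB₂) hB₆)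
  · exact h12 (Ideal.mul_mem_mul (Ideal.mul_mem_right _ _ hB₁) hsq)
  · exact h111 (Ideal.mul_mem_mul (Ideal.mul_mem_mul hB₂ hB₃) hB₃) |> fun h => by
      rwa [pow_two, ← mul_assoc]
  · exact h22 (Ideal.mul_mem_mul hsq hsq) |> fun h => by rwa [pow_two]

/-! ### The index for the normal form -/

variable {K : Type*} [Field K] [Algebra R K] [IsFractionRing R K]

/-- **`[E(K) : E₀(K)] = 2` for the normal form of type `III`** over a Henselian discrete
valuation ring: the bad points are the integral points in `𝔪 × 𝔪`, any two of them add up into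
`E₀(K)` (`hasNonsingularReduction_add_of_slope`, `e = 1`, `N = π·unit`), and `(πt, 0)` is a bad
point for a Hensel root `t` of `πt³ + a₂t² + (a₄/π)t + a₆/π²`.
[cite: SilvermanATAEC1994, IV.9.4 Step 4] -/
theorem index_eq_two_of_normalForm_III [HenselianLocalRing R] (J : WeierstrassCurve R)
    (hΔ : J.Δ ≠ 0) (h1 : J.a₁ ∈ maximalIdeal R) (h2 : J.a₂ ∈ maximalIdeal R)
    (h3 : J.a₃ ∈ maximalIdeal R) (h4 : J.a₄ ∈ maximalIdeal R) (h4' : J.a₄ ∉ maximalIdeal R ^ 2)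
    (h6 : J.a₆ ∈ maximalIdeal R ^ 2) :
    (J.nonsingularReductionSubgroup (integers_valuationRing_valuation R K)).index = 2 := by
  have hϖ : Irreducible (uniformizer R) := irreducible_uniformizer
  set ϖ := uniformizer R with hϖdef
  have hinj := IsFractionRing.injective R K
  have h6' : J.a₆ ∈ maximalIdeal R := Ideal.pow_le_self two_ne_zero h6
  -- `a₄ = ϖ δ` with `δ` a unit, `a₆ = ϖ² ε`
  obtain ⟨δ, hδ⟩ := mem_maximalIdeal_iff_dvd.mp h4
  have hδu : IsUnit δ := by
    refine IsLocalRing.notMem_maximalIdeal.mp fun hm => h4' ?_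
    rw [mem_maximalIdeal_pow_iff_dvd, hδ, pow_two]
    exact mul_dvd_mul_left _ (mem_maximalIdeal_iff_dvd.mp hm)
  obtain ⟨ε, hε⟩ := mem_maximalIdeal_pow_iff_dvd.mp h6
  -- nonsingularity of `K`-points is automatic (`Δ ≠ 0`)
  have hΔK : (J.baseChange K).Δ ≠ 0 := by
    rw [WeierstrassCurve.baseChange, WeierstrassCurve.map_Δ]; exact (map_ne_zero_iff _ hinj).mpr hΔ
  -- (a) the sum of two bad points is good
  have hadd : ∀ P Q : (J.baseChange K).toAffine.Point, ¬ J.HasNonsingularReduction P →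
      ¬ J.HasNonsingularReduction Q → J.HasNonsingularReduction (P + Q) := by
    intro P Q hP hQ
    obtain ⟨x₁, y₁, hP₁, rfl, hx₁, hy₁⟩ :=
      exists_eq_some_of_not_hasNonsingularReduction J h3 h4 h6' hP
    obtain ⟨x₂, y₂, hP₂, rfl, hx₂, hy₂⟩ :=
      exists_eq_some_of_not_hasNonsingularReduction J h3 h4 h6' hQ
    obtain ⟨a, rfl⟩ := mem_maximalIdeal_iff_dvd.mp hx₁
    obtain ⟨b, rfl⟩ := mem_maximalIdeal_iff_dvd.mp hx₂
    obtain ⟨c, hc⟩ := mem_maximalIdeal_iff_dvd.mp hy₂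
    obtain ⟨α, hα⟩ := mem_maximalIdeal_iff_dvd.mp h1
    obtain ⟨β, hβ⟩ := mem_maximalIdeal_iff_dvd.mp h2
    refine hasNonsingularReduction_add_of_slope J hϖ 1 h1 h2 h3 h4 h6' hx₁ hx₂
      (isUnit_add_mul_of_isUnit hϖ hδu (a ^ 2 + a * b + b ^ 2 + β * (a + b) - α * c)) ?_ ?_ hP₁ hP₂
    · rw [hδ, hβ, hα, hc]; ring
    · rw [pow_one]
      exact mem_maximalIdeal_iff_dvd.mp (Ideal.add_mem _ (Ideal.add_mem _ (Ideal.add_mem _ hy₁ hy₂)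
        (Ideal.mul_mem_right _ _ h1)) h3)
  -- (b) a bad point `(ϖ t, 0)`
  obtain ⟨t, ht⟩ := exists_root_of_henselian (ε := ε) (mem_maximalIdeal_iff_dvd.mpr (dvd_refl ϖ))
    h2 hδu
  have heq : (J.baseChange K).toAffine.Equation (algebraMap R K (ϖ * t)) (algebraMap R K 0) := by
    refine (WeierstrassCurve.Affine.map_equation _ hinj _ _).mpr ?_
    rw [WeierstrassCurve.Affine.equation_iff, hδ, hε]
    linear_combination (-(ϖ ^ 2)) * ht
  have hns : (J.baseChange K).toAffine.Nonsingular (algebraMap R K (ϖ * t)) (algebraMap R K 0) :=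
    (WeierstrassCurve.Affine.equation_iff_nonsingular_of_Δ_ne_zero hΔK).mp heq
  have hbad : ¬ J.HasNonsingularReduction (.some _ _ hns) :=
    not_hasNonsingularReduction_some J h3 h4 (Ideal.mul_mem_right _ _
      (mem_maximalIdeal_iff_dvd.mpr (dvd_refl ϖ))) (Ideal.zero_mem _) hns
  -- (c) index two
  refine index_eq_two_of_forall_add_mem _ (P₀ := .some _ _ hns) ?_ fun P Q hP hQ => ?_
  · rwa [WeierstrassCurve.mem_nonsingularReductionSubgroup_iff]
  · rw [WeierstrassCurve.mem_nonsingularReductionSubgroup_iff] at hP hQ ⊢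
    exact hadd P Q hP hQ

/-- **`[E(K) : E₀(K)] = 2` for type `III`** over a Henselian discrete valuation ring with perfect
residue field (Silverman, *ATAEC*, IV.9.4 Step 4: `c = 2`), for an equation `I` with `Δ ≠ 0`:
normal form, index for the normal form, invariance of the index under `R`-changes of variables.
[cite: SilvermanATAEC1994, IV.9.4 Step 4] -/
theorem index_eq_two_of_kodairaSymbolOfMinimal_eq_III [HenselianLocalRing R]
    [PerfectField (ResidueField R)] (I : WeierstrassCurve R) (hΔ : I.Δ ≠ 0)
    (hI : I.kodairaSymbolOfMinimal = .III) :
    (I.nonsingularReductionSubgroup (integers_valuationRing_valuation R K)).index = 2 := by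
  obtain ⟨D, h1, h2, h3, h4, h4', h6⟩ := exists_smul_of_kodairaSymbolOfMinimal_eq_III I hI
  rw [← index_nonsingularReductionSubgroup_smul I D]
  refine index_eq_two_of_normalForm_III (D • I) ?_ h1 h2 h3 h4 h4' h6
  rw [WeierstrassCurve.variableChange_Δ]
  exact mul_ne_zero (pow_ne_zero _ (Units.ne_zero _)) hΔ

end LocalIndex

/-! ### The discharge -/

section Discharge

open IsDedekindDomain

variable {A : Type*} [CommRing A] [IsDedekindDomain A] {K : Type*} [Field K] [Algebra A K]
  [IsFractionRing A K] (v : HeightOneSpectrum A) (W : WeierstrassCurve K)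

/-- **Discharge of `localTamagawaNumber_eq_two_of_kodairaSymbolAt_eq_III`**: `c_v = 2` for
type `III` (Silverman, *ATAEC*, IV.9.4 Step 4, PDF p. 344), by the elementary argument of this
file over the Henselian ring `O_v`. [cite: SilvermanATAEC1994, IV.9.4 Step 4 (PDF p. 344)] -/
theorem localTamagawaNumber_eq_two_of_kodairaSymbolAt_eq_III_holds :
    localTamagawaNumber_eq_two_of_kodairaSymbolAt_eq_III v W := by
  intro _ _ hk
  rw [WeierstrassCurve.kodairaSymbolAt_def] at hk
  haveI := W.isElliptic_localMinimalModel v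
  change ((W.localMinimalModel v).goodReductionSubgroup (v.adicCompletionIntegers K)).index = 2
  have key : ∀ (M : WeierstrassCurve (v.adicCompletion K))
      [M.IsMinimal (v.adicCompletionIntegers K)] [M.IsElliptic],
      (M.integralModel (v.adicCompletionIntegers K)).kodairaSymbolOfMinimal = .III →
        (M.goodReductionSubgroup (v.adicCompletionIntegers K)).index = 2 := by
    intro M _ _ hM
    obtain ⟨I, rfl⟩ : ∃ I : WeierstrassCurve (v.adicCompletionIntegers K),
        M = I.baseChange (v.adicCompletion K) := WeierstrassCurve.IsIntegral.integral
    rw [WeierstrassCurve.integralModel_baseChange_eq] at hM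
    rw [WeierstrassCurve.goodReductionSubgroup_baseChange_eq]
    refine LocalIndex.index_eq_two_of_kodairaSymbolOfMinimal_eq_III I ?_ hM
    intro h0
    apply (I.baseChange (v.adicCompletion K)).Δ'.ne_zero
    rw [WeierstrassCurve.coe_Δ', WeierstrassCurve.baseChange, WeierstrassCurve.map_Δ, h0, map_zero]
  exact key (W.localMinimalModel v) hk

end Discharge

end Literature.NumberTheory.EllipticCurves

end
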